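import Mathlib.CategoryTheory.Limits.Preserves.Shapes.Biproducts
import Literature.AlgebraicGeometry.HodgeTheory.CotangentSheafPullbackHom
import Literature.AlgebraicGeometry.GroupSchemes.CotangentSheafTranslationTrivial
import HarnessLib

/-!
# Transport of the product formula for `Ω¹` along an isomorphism of fans; the shear fan of a group scheme;
# Bosch–Lütkebohmert–Raynaud §4.2 Prop. 2 modulo the product formula

Layer `Literature/AlgebraicGeometry/HodgeTheory`; theorems only (no definition, no named fact, no instance).
Cell `pub-hodge-ring2`, crux stmt-HodgeConjecture-26512, route BLR-absolute for the named fact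
`Motives.Mumford1970_cotangentSheaf_abelianVariety_free` (captain's step (F2c)/(F3) glue): research route conditional
on HC_CM; not a corollary.

The product formula for Kähler differentials (Görtz–Wedhorn II Cor. 17.32; Bosch, *Algebraic Geometry and
Commutative Algebra*, §8.2 Prop. 6): for a binary product fan `f : P ⟶ Y`, `g : P ⟶ Z` of `k`-schemes the map
`(df, dg) : f^*Ω¹_{Y/k} ⊞ g^*Ω¹_{Z/k} ⟶ Ω¹_{P/k}` is an isomorphism (`df = cotangentSheaf.pullbackHom f`, the
tree's `HodgeTheory/CotangentSheafPullbackHom`). This file does NOT prove it; it records the formal consequences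
used by the route:

* `isIso_biprod_desc_pullbackHom_iso_comp` — **transport along an isomorphism of fans**: if `(df, dg)` is an
  isomorphism and `e : P' ≅ P`, then `(d(e ≫ f), d(e ≫ g))` is an isomorphism (chain rule
  `cotangentSheaf.pullbackHom_comp` + `isIso_pullbackHom_of_iso` + additivity of `e^*`); hence the formula for
  ANY limit fan follows from the chosen fan `(fst, snd)` of `Over (Spec k)`
  (`isIso_biprod_desc_pullbackHom_of_isLimit`);
* `isIso_biprod_desc_pullbackHom_mul_snd` — for a group object `G`: the formula at `(fst, snd)` gives it at the
  SHEAR fan `(m, snd)` (`(m, snd) = τ ≫ (fst, snd)` for the shear automorphism `τ = (m, snd)` of `G ⊗ G`,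
  `GroupSchemes/GrpObjShear.isIso_lift_mul_snd`);
* **`nonempty_cotangentSheaf_iso_pullback_unit_of_productFormula`** — BLR §4.2 Prop. 2 for `Ω¹` modulo the product
  formula at `(fst, snd)` of `G ⊗ G`: `Ω¹_G ≅ π^* e^* Ω¹_G` (`GroupSchemes/CotangentSheafTranslationTrivial`:
  `isoOfIsIsoBiprodDesc` gives `m^*Ω¹ ≅ fst^*Ω¹`, then `nonempty_iso_pullback_pullback_unit`).

presearch: «product formula Kähler differentials fibre product isomorphism of fans» → [corpus: book:gortz2023,
Cor. 17.32 ∕ Prop. 17.30] (page-read by hav-input-mumford-omega1-free, INBOX l.5736) + [corpus: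
book:bosch2013-algebraic-geometry-commutative-algebra chunk p0407, §8.2 Prop. 6]; galaxy «product of differentials|
Ω of a product» → none relevant; Mathlib: ring-level base change only (`KaehlerDifferential.tensorKaehlerEquiv`);
tree: ring-level product formula `Algebra/Derivations/KaehlerDifferentialTensorProduct` (p661983), no sheaf form yet.

## References
* [GortzWedhorn2023] U. Görtz, T. Wedhorn, *Algebraic Geometry II* (2023), Prop. 17.30, Cor. 17.32, (17.5.6)–(17.5.7).
* [BoschLutkebohmertRaynaud1990] S. Bosch, W. Lütkebohmert, M. Raynaud, *Néron Models* (1990), §4.2 Prop. 2.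
* [Hartshorne1977] R. Hartshorne, *Algebraic Geometry* (1977), II Prop. 8.10, Prop. 8.11, Ex. 8.3.
-/

noncomputable section

-- `TopCat.Presheaf`/`Scheme.Modules` are not reducible (as in Mathlib's `AlgebraicGeometry/Modules/Sheaf.lean`).
set_option backward.isDefEq.respectTransparency false

universe u

open CategoryTheory CategoryTheory.Limits MonoidalCategory CartesianMonoidalCategory MonObj AlgebraicGeometry

namespace Literature.AlgebraicGeometry.HodgeTheory

open Literature.AlgebraicGeometry.Motives Literature.AlgebraicGeometry.GroupSchemes

/-! ## §1 Transport of the product formula along an isomorphism of fans -/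

section Transport

variable {k : Type u} [CommRing k] {P P' Y Z : Over (Spec (CommRingCat.of k))} (e : P' ≅ P) (f : P ⟶ Y) (g : P ⟶ Z)

/-- The map `(d(e ≫ f), d(e ≫ g))` factors as «pseudofunctoriality isomorphisms» ≫ `(e^* df, e^* dg)` ≫ `de`
(chain rule for `1`-forms, `cotangentSheaf.pullbackHom_comp`).
[cite: Hartshorne1977, II Prop. 8.11 (functoriality of f^*Ω_{Y/Z} → Ω_{X/Z})] -/
theorem biprod_desc_pullbackHom_iso_comp :
    biprod.desc (cotangentSheaf.pullbackHom (e.hom ≫ f)) (cotangentSheaf.pullbackHom (e.hom ≫ g)) =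
      biprod.map ((Scheme.Modules.pullbackComp e.hom.left f.left).inv.app (cotangentSheaf Y))
          ((Scheme.Modules.pullbackComp e.hom.left g.left).inv.app (cotangentSheaf Z)) ≫
        biprod.desc ((Scheme.Modules.pullback e.hom.left).map (cotangentSheaf.pullbackHom f))
            ((Scheme.Modules.pullback e.hom.left).map (cotangentSheaf.pullbackHom g)) ≫
          cotangentSheaf.pullbackHom e.hom := by
  apply biprod.hom_ext'
  · rw [biprod.inl_desc, biprod.inl_map_assoc, biprod.inl_desc_assoc, cotangentSheaf.pullbackHom_comp]
  · rw [biprod.inr_desc, biprod.inr_map_assoc, biprod.inr_desc_assoc, cotangentSheaf.pullbackHom_comp]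

/-- For an additive functor `F` and an isomorphism `(a, b) : X ⊞ Q ⟶ W`, `(F a, F b)` is an isomorphism
(`F` preserves binary biproducts). [folklore] -/
private theorem isIso_biprod_desc_map {C D : Type*} [Category C] [Category D] [Preadditive C] [Preadditive D]
    [HasBinaryBiproducts C] [HasBinaryBiproducts D] (F : C ⥤ D) [F.Additive] {X Q W : C} (a : X ⟶ W)
    (b : Q ⟶ W) [IsIso (biprod.desc a b)] : IsIso (biprod.desc (F.map a) (F.map b)) := by
  haveI : PreservesBinaryBiproducts F := preservesBinaryBiproducts_of_preservesBiproducts F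
  rw [← biprod.mapBiprod_inv_map_desc]
  infer_instance

/-- **Transport of the product formula along an isomorphism of fans**: if
`(df, dg) : f^*Ω¹_Y ⊞ g^*Ω¹_Z ⟶ Ω¹_P` is an isomorphism and `e : P' ≅ P`, then so is `(d(e ≫ f), d(e ≫ g))`.
[cite: GortzWedhorn2023, Cor. 17.32 (the isomorphism is canonical, hence compatible with isomorphisms of products)] -/
theorem isIso_biprod_desc_pullbackHom_iso_comp
    [IsIso (biprod.desc (cotangentSheaf.pullbackHom f) (cotangentSheaf.pullbackHom g))] :
    IsIso (biprod.desc (cotangentSheaf.pullbackHom (e.hom ≫ f)) (cotangentSheaf.pullbackHom (e.hom ≫ g))) := by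
  rw [biprod_desc_pullbackHom_iso_comp]
  change IsIso ((biprod.mapIso ((Scheme.Modules.pullbackComp e.hom.left f.left).app (cotangentSheaf Y)).symm
    ((Scheme.Modules.pullbackComp e.hom.left g.left).app (cotangentSheaf Z)).symm).hom ≫ _ ≫ _)
  refine @IsIso.comp_isIso _ _ _ _ _ _ _ inferInstance (@IsIso.comp_isIso _ _ _ _ _ _ _ ?_ ?_)
  · exact isIso_biprod_desc_map (Scheme.Modules.pullback e.hom.left) (cotangentSheaf.pullbackHom f)
      (cotangentSheaf.pullbackHom g)
  · exact cotangentSheaf.isIso_pullbackHom_of_iso e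

variable {f g} in
/-- The same with the composites named: `e ≫ f = f'`, `e ≫ g = g'`.
[cite: GortzWedhorn2023, Cor. 17.32 (the isomorphism is canonical, hence compatible with isomorphisms of products)] -/
theorem isIso_biprod_desc_pullbackHom_of_iso_comp_eq {f' : P' ⟶ Y} {g' : P' ⟶ Z} (hf : e.hom ≫ f = f')
    (hg : e.hom ≫ g = g') [IsIso (biprod.desc (cotangentSheaf.pullbackHom f) (cotangentSheaf.pullbackHom g))] :
    IsIso (biprod.desc (cotangentSheaf.pullbackHom f') (cotangentSheaf.pullbackHom g')) := by
  subst hf hg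
  exact isIso_biprod_desc_pullbackHom_iso_comp e f g

/-- **The product formula for any limit fan from the chosen one**: if `(d fst, d snd)` is an isomorphism for the
chosen product `Y ⊗ Z` of `Over (Spec k)`, then `(d c.fst, d c.snd)` is an isomorphism for every limit binary
fan `c` of `Y`, `Z`. [cite: GortzWedhorn2023, Cor. 17.32] -/
theorem isIso_biprod_desc_pullbackHom_of_isLimit
    [IsIso (biprod.desc (cotangentSheaf.pullbackHom (fst Y Z)) (cotangentSheaf.pullbackHom (snd Y Z)))]
    (c : BinaryFan Y Z) (hc : IsLimit c) :
    IsIso (biprod.desc (cotangentSheaf.pullbackHom c.fst) (cotangentSheaf.pullbackHom c.snd)) :=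
  isIso_biprod_desc_pullbackHom_of_iso_comp_eq (f := fst Y Z) (g := snd Y Z)
    (hc.conePointUniqueUpToIso (tensorProductIsBinaryProduct Y Z))
    (by exact hc.conePointUniqueUpToIso_hom_comp (tensorProductIsBinaryProduct Y Z) ⟨WalkingPair.left⟩)
    (by exact hc.conePointUniqueUpToIso_hom_comp (tensorProductIsBinaryProduct Y Z) ⟨WalkingPair.right⟩)

end Transport

/-! ## §2 The shear fan of a group scheme and BLR §4.2 Prop. 2 modulo the product formula -/

section Shear

variable {k : Type u} [CommRing k] (G : Over (Spec (CommRingCat.of k))) [GrpObj G]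

/-- **The product formula at the shear fan** `(m, snd) : G ⊗ G ⟶ G, G`: from the formula at `(fst, snd)`, since
`(m, snd) = τ ≫ (fst, snd)` for the shear automorphism `τ = (m, snd)` of `G ⊗ G`.
[cite: BoschLutkebohmertRaynaud1990, §4.2 Prop. 2 (proof: the universal translation is an automorphism of G ×_S G over p₂)] -/
theorem isIso_biprod_desc_pullbackHom_mul_snd
    [IsIso (biprod.desc (cotangentSheaf.pullbackHom (fst G G)) (cotangentSheaf.pullbackHom (snd G G)))] :
    IsIso (biprod.desc (cotangentSheaf.pullbackHom μ[G]) (cotangentSheaf.pullbackHom (snd G G))) :=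
  haveI := isIso_lift_mul_snd G
  isIso_biprod_desc_pullbackHom_of_iso_comp_eq (asIso (lift μ[G] (snd G G))) (lift_fst _ _) (lift_snd _ _)

/-- **`m^*Ω¹_G ≅ fst^*Ω¹_G` on `G ⊗ G`** (Bosch–Lütkebohmert–Raynaud: `Ω¹_{G×G/G} ≅ p₁^*Ω¹_G` and the
`G`-automorphism `(m, p₂)`), granted the product formula at `(fst, snd)`: the two decompositions
`(d fst, d snd)` and `(d m, d snd)` of `Ω¹_{G ⊗ G}` share the summand `d snd`.
[cite: BoschLutkebohmertRaynaud1990, §4.2 Prop. 2 (proof)] -/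
theorem nonempty_pullback_mul_cotangentSheaf_iso_pullback_fst
    [IsIso (biprod.desc (cotangentSheaf.pullbackHom (fst G G)) (cotangentSheaf.pullbackHom (snd G G)))] :
    Nonempty ((Scheme.Modules.pullback μ[G].left).obj (cotangentSheaf G) ≅
      (Scheme.Modules.pullback (fst G G).left).obj (cotangentSheaf G)) :=
  haveI := isIso_biprod_desc_pullbackHom_mul_snd G
  ⟨isoOfIsIsoBiprodDesc (cotangentSheaf.pullbackHom μ[G]) (cotangentSheaf.pullbackHom (fst G G))
    (cotangentSheaf.pullbackHom (snd G G))⟩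

/-- **Bosch–Lütkebohmert–Raynaud §4.2 Prop. 2 for `Ω¹`, modulo the product formula**: for a group scheme `G`
over `Spec k` (any commutative ring `k`) whose square satisfies the product formula at `(fst, snd)`,
`Ω¹_{G/k} ≅ π^* e^* Ω¹_{G/k}` — the cotangent sheaf is pulled back from its restriction along the unit section.
[cite: BoschLutkebohmertRaynaud1990, §4.2 Prop. 2] -/
theorem nonempty_cotangentSheaf_iso_pullback_unit_of_productFormula
    [IsIso (biprod.desc (cotangentSheaf.pullbackHom (fst G G)) (cotangentSheaf.pullbackHom (snd G G)))] :
    Nonempty (cotangentSheaf G ≅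
      (Scheme.Modules.pullback G.hom).obj ((Scheme.Modules.pullback η[G].left).obj (cotangentSheaf G))) := by
  obtain ⟨ψ⟩ := nonempty_pullback_mul_cotangentSheaf_iso_pullback_fst G
  exact nonempty_iso_pullback_pullback_unit G (cotangentSheaf G) ψ

end Shear

end Literature.AlgebraicGeometry.HodgeTheory

end
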